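import Mathlib
import Summits.ValiantsHypothesis.ValiantsHypothesis.Theses.RigidityForcesSymmetry
import Summits.ValiantsHypothesis.ValiantsHypothesis.Theorems.RigidityForcesSymmetryRankRigidMinimalReprLaplaceFivePropA

/-!
# Crux idea `young-shadow` for `LaplaceOptimalFive` (stmt-ValiantsHypothesis-24813) — sketch (val-idea-19 g6)

HONEST LABEL.  `LaplaceOptimalFive` (= `LaplaceOptimal 5`, «every split decomposition of `P₅` has Laplace weight `≥ 120`») is
OPEN · CONTESTED 72/120; nothing here proves it; `RankRigidMinimalRepr` (18034) does not move; VP ≠ VNP is NOT proved.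

THE LEVER (slot-isotypic / Young-shadow reading).  A split term `u ⊗_S w` has a short factor `u ∈ V^{⊗S}` and a long factor
`w ∈ V^{⊗Sᶜ}`; decompose each under the permutations of the SLOTS of its own side: `u = Sym_S u + (non-symmetric part)`,
`w = Sym_{Sᶜ} w + (…)`.  `P₅ ∈ Sym⁵ V` is purely `(5)`-isotypic for `S₅` acting on the five slots, so the 3125 equations
`Σ_t u_t ⊗ w_t = P₅` split into REAGENT isotypics `(5) ⊕ (4,1) ⊕ (3,2)` (dims 126 + 896 + 875 — the only ones a product of two
side-symmetric factors can reach, Pieri) and CATALYST isotypics `(3,1,1) ⊕ (2,2,1) ⊕ (2,1,1,1) ⊕ (1⁵)` (756 + 375 + 96 + 1,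
homogeneous equations).  The YOUNG SHADOW of a decomposition on the pair split `S` is `Z_S := Σ_{t : S_t = S} Sym u_t ⊗ Sym w_t
∈ Sym²V ⊗ Sym³V`; its `(5)`-part is a catalecticant block, and the ISOTYPIC FLUX `Φ := ((4,1) ⊕ (3,2))`-part of `Σ_S ι_S Z_S` is a
function of the FACTORS — zero on side-symmetric decompositions, finite on honest ones, DIVERGENT (`~ ε⁻¹`) along the certified
star border family: a non-closed quantity separating honest / border, which is what «exactly true, border-false» must see.

CONTENTS.
* `SlotInvariantOn`, `SideSymmetric`, `IsSplitDecomposition`, `laplaceWeight` — definitions over `ℂ`.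
* `SideSymLaplaceOptimalFive` (K1 = the symmetric sector) and `AsymLaplaceOptimalFive` (K2 = the honest remaining slice);
  `laplaceOptimalFive_of_sectors : K1 → K2 → LaplaceOptimalFive` and `sideSym_of_laplaceOptimalFive : LaplaceOptimalFive → K1`
  (PROVED: the split is a genuine case split of the crux, not a strengthening).
* kernel facts (decide) on the certified star border family of p629937 in the factor normal form of the g5 sketch
  (`ArcHeightSketch.lean`: eight pole terms `(a_t + ε b_t) ⊗ (p_t + ε q_t)` on the slot pairs `01,01,02,02,03,03,04,04` plus
  `ε · M₀₁ ⊗ Q₂₃₄`):  `longSym_kills_YA1/YB1/YB`, `longSym_YA` — long-side symmetrisation kills three of the four leading long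
  factors and maps `Y_A ↦ Q`;  `shadowLead12_witness` / `shadowLead12_support` — the side-symmetrised LEADING layer (which is `0`
  before symmetrisation: `lead_syzygy`) does NOT vanish: `12·Σ_t Sym a_t ⊗ Sym p_t` equals `−12` at the word `(0,3,0,1,3)` and is
  supported on the 24 words of content `{0,0,1,3,3}` (so it has no `(5)`-part: the flux of the family is `ε⁻¹·(this tensor) + O(1)`,
  isotypic content `(4,1) ⊕ (3,2)`);  `shadowOne12_witness` — the side-symmetrised `ε⁰` layer is NOT `P₅` (`6 ≠ 12` at `01234`).
* `twoSplit_separation` (PROVED over `ℂ`, with the kernel lemma `pair_cover`: two Young subgroups `S₂ × S₃` generate `S₅`,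
  effectively): a fully symmetric sum of two side-symmetric shadows on distinct pair splits has fully symmetric summands.
* δ-WIRE (val-idea-19 g7, lineage pen, 2026-08-28; val-lit-p4 g14 18:26:51Z ask, director R282 (2)(d) / R286 (1)): the three former
  stubs are CLOSED BY NAME from `Theorems/` — `stub_threeSplit_separation := LaplaceFiveThreeSplit.threeSplit_separation` (✓ p656799,
  val-lit-p4 g14; chain ✓ p655191 triangle / ✓ p656331 star·path·pathEdge / helper ✓ p656592 cross-swap, 24813-w1 g3),
  `stub_symmetricPieces_needTen := LaplaceFiveSymmetricPieces.symmetricPieces_needTen` (✓ p654341),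
  `stub_sideSym_threePairSplits := LaplaceFivePropA.sideSym_threePairSplits` (✓ p657029) — the sketch keeps its own §1 definitions
  (bodies identical to the port ✓ p654450 `…LaplaceFiveSectorSplitDefs`, 24813-w1 g3), so each wire is an `exact` through `δ`-unfolding;
  the file is now sorry-free.  Names kept (`stub_*`) for the record.  What stays OPEN in K1 = supports with ≥ 4 distinct pair splits
  (crit-3 g4 census 18:17:29Z: separation still holds for P₅-path / chair / paw quadruples and fails for K₁,₄ / C₄ / K₃⊔K₂ and every
  k ≥ 5 — the relation moduli); line of record `Lines/shallow_collision.lean` rev 4′ (S2′ `stub_sideSym_offShell_five`).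
* former stubs (the line's first targets, now theorems): `stub_threeSplit_separation` (Young-invariant-vector independence ⟹ shadows separate), `stub_symmetricPieces_needTen` (catalecticant of `x₀x₁x₂x₃x₄` has rank 10),
  `stub_sideSym_threePairSplits` (Prop A: side-symmetric decompositions supported on ≤ 3 pair splits cost ≥ 120).
-/

set_option linter.style.longLine false
set_option linter.unusedVariables false
set_option autoImplicit false
set_option linter.dupNamespace false

namespace Summit.ValiantsHypothesis.ValiantsHypothesis.Cruxes.LaplaceOptimalFive.YoungShadow

open Finset

/-! ### 1. The symmetric sector (definitions over `ℂ`) -/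

/-- `T : (Fin 5 → Fin 5) → ℂ` (a tensor in `V^{⊗5}`, `V = ℂ⁵`, read as a function of words) is invariant under every permutation
of the SLOTS that fixes the slots outside `A` pointwise; the action is `(τ • T) v = T (v ∘ τ)`. -/
def SlotInvariantOn (A : Finset (Fin 5)) (T : (Fin 5 → Fin 5) → ℂ) : Prop :=
  ∀ τ : Equiv.Perm (Fin 5), (∀ i, i ∉ A → τ i = i) → ∀ v : Fin 5 → Fin 5, T (v ∘ ⇑τ) = T v

/-- A family of split terms `(S t, u t, w t)_{t ∈ T}` is SIDE-SYMMETRIC when every short factor is symmetric in the slots of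
`S t` and every long factor is symmetric in the slots of `(S t)ᶜ` (e.g. an honest Laplace term `perm-minor ⊗ complementary
perm-minor`, or any term whose factors are polarisations of homogeneous polynomials). -/
def SideSymmetric {N : ℕ} (T : Finset (Fin N)) (S : Fin N → Finset (Fin 5)) (u w : Fin N → (Fin 5 → Fin 5) → ℂ) : Prop :=
  ∀ t ∈ T, SlotInvariantOn (S t) (u t) ∧ SlotInvariantOn (S t)ᶜ (w t)

/-- The three hypotheses of `LaplaceOptimalFive`: short factors read only the slots in `S t`, long factors only the slots
outside `S t`, and the terms sum to the pattern `P₅ = [v injective]`. -/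
def IsSplitDecomposition {N : ℕ} (T : Finset (Fin N)) (S : Fin N → Finset (Fin 5)) (u w : Fin N → (Fin 5 → Fin 5) → ℂ) : Prop :=
  (∀ t, ∀ v v' : Fin 5 → Fin 5, (∀ i ∈ S t, v i = v' i) → u t v = u t v') ∧
  (∀ t, ∀ v v' : Fin 5 → Fin 5, (∀ i, i ∉ S t → v i = v' i) → w t v = w t v') ∧
  (∀ v : Fin 5 → Fin 5, (∑ t ∈ T, u t v * w t v) = if Function.Injective v then 1 else 0)

/-- The Laplace weight `Σ_t |S_t|! (5 − |S_t|)!` (pair / triple splits cost 12, slices 24). -/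
def laplaceWeight {N : ℕ} (T : Finset (Fin N)) (S : Fin N → Finset (Fin 5)) : ℕ :=
  ∑ t ∈ T, (S t).card.factorial * (5 - (S t).card).factorial

/-- K1 — THE SYMMETRIC SECTOR `SymLO5`: every SIDE-SYMMETRIC split decomposition of `P₅` has weight `≥ 120`.
A consequence of the crux (`sideSym_of_laplaceOptimalFive`).  On RIGID supports (Young-invariant vectors independent: every
support with ≤ 3 pair splits, paw, chair, path) it falls to CLOSED tools (separation + the catalecticant of `x₀⋯x₄`, Prop A below);
on SLACK supports (star `K_{1,4}`, `C₄`, `K₃ ⊔ K₂`, ≥ 5 splits) the relation moduli `Rel^λ(G)` enter.  CALIBRATION: the honest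
weight-648 decomposition of `P₆` (`LaplaceSixExact.not_laplaceOptimal_six`) IS side-symmetric (all its factors are arrangement /
multiset indicators `N_S, K_S, [v₀=v₁=x], [rest ∈ Arr(multiset)]`), so the `d = 6` analogue of K1 is FALSE: the symmetric sector is
exactly where even-`d` cheapness lives, and K1 sees the parity of `d` only through the relation count of Young-invariant vectors
(at `d = 5`: none on ≤ 3 pair splits; at `d = 6`: the ten `3|3` half-splits carry ≥ 5 + 1 + 5 relations in `S^{(5,1)}, S^{(4,2)},
S^{(3,3)}`).  The certified `d = 5` border family, by contrast, lives in the ASYMMETRIC sector (`shadowLead12_witness`). -/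
def SideSymLaplaceOptimalFive : Prop :=
  ∀ (N : ℕ) (T : Finset (Fin N)) (S : Fin N → Finset (Fin 5)) (u w : Fin N → (Fin 5 → Fin 5) → ℂ),
    IsSplitDecomposition T S u w → SideSymmetric T S u w → Nat.factorial 5 ≤ laplaceWeight T S

/-- K2 — THE ASYMMETRIC SLICE (honest remainder of the crux): every split decomposition of `P₅` that is NOT side-symmetric has
weight `≥ 120`.  This is the sector of the certified border families (divergent isotypic flux); exactness forces the reagent
output of the asymmetric channels to be compensated EXACTLY by the Young shadows (`Σ_S ι_S Z_S = P₅ − F`), i.e. the shadows solve a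
flux-perturbed symmetric problem.  No mechanism for K2 is claimed here beyond this normal form. -/
def AsymLaplaceOptimalFive : Prop :=
  ∀ (N : ℕ) (T : Finset (Fin N)) (S : Fin N → Finset (Fin 5)) (u w : Fin N → (Fin 5 → Fin 5) → ℂ),
    IsSplitDecomposition T S u w → ¬ SideSymmetric T S u w → Nat.factorial 5 ≤ laplaceWeight T S

/-- COMPOSITION (proved): the two sectors together are exactly the crux. -/
theorem laplaceOptimalFive_of_sectors (h1 : SideSymLaplaceOptimalFive) (h2 : AsymLaplaceOptimalFive) :
    Summit.ValiantsHypothesis.ValiantsHypothesis.Theses.RigidityForcesSymmetry.LaplaceOptimalFive := by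
  intro N T S u w hu hw hsum
  by_cases hs : SideSymmetric T S u w
  · exact h1 N T S u w ⟨hu, hw, hsum⟩ hs
  · exact h2 N T S u w ⟨hu, hw, hsum⟩ hs

/-- HONESTY (proved): K1 is a consequence of the crux (a sector, not a strengthening). -/
theorem sideSym_of_laplaceOptimalFive
    (h : Summit.ValiantsHypothesis.ValiantsHypothesis.Theses.RigidityForcesSymmetry.LaplaceOptimalFive) :
    SideSymLaplaceOptimalFive := by
  intro N T S u w hdec _hs
  exact h N T S u w hdec.1 hdec.2.1 hdec.2.2

/-- HONESTY (proved): so is K2. -/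
theorem asym_of_laplaceOptimalFive
    (h : Summit.ValiantsHypothesis.ValiantsHypothesis.Theses.RigidityForcesSymmetry.LaplaceOptimalFive) :
    AsymLaplaceOptimalFive := by
  intro N T S u w hdec _hs
  exact h N T S u w hdec.1 hdec.2.1 hdec.2.2

/-! ### 2. The engine of K1 (stubs = the line's first targets)

Young-invariant vectors: for a pair split `S` the `S₂(S) × S₃(Sᶜ)`-invariant line of the Specht module `S^λ` (`λ ∈ {(4,1),(3,2)}`,
Kostka `K_{λ,(3,2)} = 1`) is spanned by `ξ^λ_S`; Gram data in `M^{(3,2)} = ℚ^{J(5,2)}` (Petersen algebra, cf.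
`LaplaceFivePairCore.flattening_kernel`): `⟨ξ^{41}_S, ξ^{41}_{S'}⟩ = 6 / 1 / −4` and `⟨ξ^{32}_S, ξ^{32}_{S'}⟩ = 3 / −1 / 1` for
`S = S'` / `|S ∩ S'| = 1` / `S ∩ S' = ∅`.  RIGIDITY TABLE (calc/isotypic.py E1, exact): the `ξ^{41}` resp. `ξ^{32}` of a set `G` of
pair splits (= a graph on the 5 slots) have `|G| − rank` relations = (0,0) for every `G` with ≤ 3 edges and for paw, chair, `P₅`-path;
star `K_{1,4}`: (0,1) (`Σ_j ξ^{32}_{0j} = 0`); `C₄`: (1,0); `K₃ ⊔ K₂`: (1,1); 5 edges: (1,·); 6: (2,·); …; `K₅`: (6,5).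
On a rigid support an exact side-symmetric decomposition has every shadow `Z_S` FULLY `S₅`-symmetric. -/

/-- Invariance of a tensor under ONE slot permutation. -/
def InvUnder (τ : Equiv.Perm (Fin 5)) (T : (Fin 5 → Fin 5) → ℂ) : Prop := ∀ v : Fin 5 → Fin 5, T (v ∘ ⇑τ) = T v

theorem invUnder_mul {σ τ : Equiv.Perm (Fin 5)} {T : (Fin 5 → Fin 5) → ℂ} (hσ : InvUnder σ T) (hτ : InvUnder τ T) :
    InvUnder (σ * τ) T := by
  intro v
  have h : v ∘ ⇑(σ * τ) = (v ∘ ⇑σ) ∘ ⇑τ := by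
    funext i; simp [Equiv.Perm.coe_mul, Function.comp]
  rw [h, hτ, hσ]

theorem invUnder_swap_of_mem {A : Finset (Fin 5)} {T : (Fin 5 → Fin 5) → ℂ} (h : SlotInvariantOn A T) {a b : Fin 5}
    (ha : a ∈ A) (hb : b ∈ A) : InvUnder (Equiv.swap a b) T := by
  intro v
  exact h (Equiv.swap a b) (fun i hi => Equiv.swap_apply_of_ne_of_ne (fun h' => hi (h' ▸ ha)) (fun h' => hi (h' ▸ hb))) v

theorem invUnder_swap_of_not_mem {A : Finset (Fin 5)} {T : (Fin 5 → Fin 5) → ℂ} (h : SlotInvariantOn Aᶜ T) {a b : Fin 5}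
    (ha : a ∉ A) (hb : b ∉ A) : InvUnder (Equiv.swap a b) T :=
  invUnder_swap_of_mem h (Finset.mem_compl.mpr ha) (Finset.mem_compl.mpr hb)

theorem invUnder_of_add_left {τ : Equiv.Perm (Fin 5)} {T₁ T₂ : (Fin 5 → Fin 5) → ℂ} (h12 : InvUnder τ (T₁ + T₂))
    (h1 : InvUnder τ T₁) : InvUnder τ T₂ := by
  intro v
  have h := h12 v
  simp only [Pi.add_apply] at h
  rw [h1 v] at h
  linear_combination h

theorem invUnder_of_add_right {τ : Equiv.Perm (Fin 5)} {T₁ T₂ : (Fin 5 → Fin 5) → ℂ} (h12 : InvUnder τ (T₁ + T₂))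
    (h2 : InvUnder τ T₂) : InvUnder τ T₁ := by
  intro v
  have h := h12 v
  simp only [Pi.add_apply] at h
  rw [h2 v] at h
  linear_combination h

/-- The transpositions DIRECTLY available from the two Young subgroups of the pair splits `{p,q}` and `{r,s}` (both letters on
the same side of one of the two splits), as a Prop … -/
def AvP (p q r s x y : Fin 5) : Prop :=
  ((x = p ∨ x = q) ∧ (y = p ∨ y = q)) ∨ (¬(x = p ∨ x = q) ∧ ¬(y = p ∨ y = q)) ∨
  ((x = r ∨ x = s) ∧ (y = r ∨ y = s)) ∨ (¬(x = r ∨ x = s) ∧ ¬(y = r ∨ y = s))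

/-- … and as a Boolean test (for `decide`). -/
def av (p q r s x y : Fin 5) : Bool :=
  decide (((x = p ∨ x = q) ∧ (y = p ∨ y = q)) ∨ (¬(x = p ∨ x = q) ∧ ¬(y = p ∨ y = q)) ∨
    ((x = r ∨ x = s) ∧ (y = r ∨ y = s)) ∨ (¬(x = r ∨ x = s) ∧ ¬(y = r ∨ y = s)))

theorem avP_of_av {p q r s x y : Fin 5} (h : av p q r s x y = true) : AvP p q r s x y := by
  unfold av at h
  unfold AvP
  exact of_decide_eq_true h

/-- COMBINATORIAL CORE (kernel, decide): for two distinct pair splits every transposition of the five slots is directly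
available or a conjugate `(c x)(y c)(c x) = (x y)` of two directly available ones — i.e. the two Young subgroups `S₂ × S₃`
generate `S₅` (maximality), in the effective form the separation proof uses. -/
theorem pair_cover : ∀ p q r s : Fin 5, p ≠ q → r ≠ s → ¬((p = r ∧ q = s) ∨ (p = s ∧ q = r)) →
    ∀ x y : Fin 5, x ≠ y → av p q r s x y = true ∨
      ∃ c : Fin 5, c ≠ x ∧ c ≠ y ∧ av p q r s x c = true ∧ av p q r s c y = true := by
  decide

/-- TWO-SPLIT SEPARATION (PROVED over `ℂ`; the idea's First lemma in its smallest case): if `Z₁ + Z₂` is fully slot-symmetric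
and `Z_k` is symmetric within both sides of the pair split `S_k` (`S₁ ≠ S₂`), then each `Z_k` is fully symmetric — the Young
shadows of an exact side-symmetric decomposition on two splits are symmetric tensors (polynomials), whence catalecticant bounds. -/
theorem twoSplit_separation (S₁ S₂ : Finset (Fin 5)) (h₁ : S₁.card = 2) (h₂ : S₂.card = 2) (h12 : S₁ ≠ S₂)
    (Z₁ Z₂ : (Fin 5 → Fin 5) → ℂ)
    (hZ₁ : SlotInvariantOn S₁ Z₁ ∧ SlotInvariantOn S₁ᶜ Z₁) (hZ₂ : SlotInvariantOn S₂ Z₂ ∧ SlotInvariantOn S₂ᶜ Z₂)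
    (hsum : SlotInvariantOn Finset.univ (Z₁ + Z₂)) :
    SlotInvariantOn Finset.univ Z₁ ∧ SlotInvariantOn Finset.univ Z₂ := by
  obtain ⟨p, q, hpq, rfl⟩ := Finset.card_eq_two.mp h₁
  obtain ⟨r, s, hrs, rfl⟩ := Finset.card_eq_two.mp h₂
  have hne : ¬((p = r ∧ q = s) ∨ (p = s ∧ q = r)) := by
    rintro (⟨rfl, rfl⟩ | ⟨rfl, rfl⟩)
    · exact h12 rfl
    · exact h12 (Finset.pair_comm p q)
  have hfull : ∀ τ : Equiv.Perm (Fin 5), InvUnder τ (Z₁ + Z₂) :=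
    fun τ v => hsum τ (fun i hi => absurd (Finset.mem_univ i) hi) v
  have mem_pair : ∀ {a b x : Fin 5}, (x = a ∨ x = b) → x ∈ ({a, b} : Finset (Fin 5)) := by
    intro a b x hx
    rcases hx with rfl | rfl <;> simp
  have not_mem_pair : ∀ {a b x : Fin 5}, ¬(x = a ∨ x = b) → x ∉ ({a, b} : Finset (Fin 5)) := by
    intro a b x hx h
    simp only [Finset.mem_insert, Finset.mem_singleton] at h
    exact hx h
  have hAv : ∀ x y : Fin 5, av p q r s x y = true → InvUnder (Equiv.swap x y) Z₂ := by
    intro x y hxy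
    rcases avP_of_av hxy with h | h | h | h
    · exact invUnder_of_add_left (hfull _) (invUnder_swap_of_mem hZ₁.1 (mem_pair h.1) (mem_pair h.2))
    · exact invUnder_of_add_left (hfull _) (invUnder_swap_of_not_mem hZ₁.2 (not_mem_pair h.1) (not_mem_pair h.2))
    · exact invUnder_swap_of_mem hZ₂.1 (mem_pair h.1) (mem_pair h.2)
    · exact invUnder_swap_of_not_mem hZ₂.2 (not_mem_pair h.1) (not_mem_pair h.2)
  have hswap : ∀ x y : Fin 5, x ≠ y → InvUnder (Equiv.swap x y) Z₂ := by
    intro x y hxy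
    rcases pair_cover p q r s hpq hrs hne x y hxy with h | ⟨c, hcx, hcy, hxc, hcy'⟩
    · exact hAv x y h
    · -- `swap c x * swap y c * swap c x = swap x y` (Equiv.swap_mul_swap_mul_swap with (x,y,z) := (y,c,x))
      have key : Equiv.swap c x * Equiv.swap y c * Equiv.swap c x = Equiv.swap x y :=
        Equiv.swap_mul_swap_mul_swap (x := y) (y := c) (z := x) (fun h => hcy h.symm) (fun h => hxy h.symm)
      have h1 : InvUnder (Equiv.swap c x) Z₂ := by rw [Equiv.swap_comm]; exact hAv x c hxc
      have h2 : InvUnder (Equiv.swap y c) Z₂ := by rw [Equiv.swap_comm]; exact hAv c y hcy'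
      rw [← key]
      exact invUnder_mul (invUnder_mul h1 h2) h1
  have hZ₂full : ∀ τ : Equiv.Perm (Fin 5), InvUnder τ Z₂ := by
    intro τ
    induction τ using Equiv.Perm.swap_induction_on with
    | one => intro v; simp
    | swap_mul f x y hxy ih => exact invUnder_mul (hswap x y hxy) ih
  refine ⟨fun τ _ v => ?_, fun τ _ v => hZ₂full τ v⟩
  exact invUnder_of_add_right (hfull τ) (hZ₂full τ) v

/-- THREE-SPLIT SEPARATION (the rigidity table at `|G| = 3`: for each of the four orbit types of three distinct pair splits the
vectors `ξ^{41}_{S_k}` and `ξ^{32}_{S_k}` are linearly independent — Gram determinants 200/200/100/50 and 16/16/20/16): a fully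
symmetric sum of three side-symmetric shadows on distinct pair splits has fully symmetric summands. -/
theorem stub_threeSplit_separation (S₁ S₂ S₃ : Finset (Fin 5)) (h₁ : S₁.card = 2) (h₂ : S₂.card = 2) (h₃ : S₃.card = 2)
    (h12 : S₁ ≠ S₂) (h13 : S₁ ≠ S₃) (h23 : S₂ ≠ S₃) (Z₁ Z₂ Z₃ : (Fin 5 → Fin 5) → ℂ)
    (hZ₁ : SlotInvariantOn S₁ Z₁ ∧ SlotInvariantOn S₁ᶜ Z₁) (hZ₂ : SlotInvariantOn S₂ Z₂ ∧ SlotInvariantOn S₂ᶜ Z₂)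
    (hZ₃ : SlotInvariantOn S₃ Z₃ ∧ SlotInvariantOn S₃ᶜ Z₃) (hsum : SlotInvariantOn Finset.univ (Z₁ + Z₂ + Z₃)) :
    SlotInvariantOn Finset.univ Z₁ ∧ SlotInvariantOn Finset.univ Z₂ ∧ SlotInvariantOn Finset.univ Z₃ := by
  -- CLOSED BY NAME ✓ p656799 (val-lit-p4 g14); `SlotInvariantOn` here and in the port have identical bodies (δ-unfolding).
  exact Summit.ValiantsHypothesis.ValiantsHypothesis.Theorems.RigidityForcesSymmetryRankRigidMinimalRepr.LaplaceFiveThreeSplit.threeSplit_separation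
    S₁ S₂ S₃ h₁ h₂ h₃ h12 h13 h23 Z₁ Z₂ Z₃ hZ₁ hZ₂ hZ₃ hsum

/-- CATALECTICANT STEP (closed, classical: `rank Cat_{2,3}(x₀x₁x₂x₃x₄) = C(5,2) = 10`, Ranestad–Schreyer / Carlini–Catalisano–
Geramita; in-tree form: the `2|3` flattening of `P₅` has rank 10): if `P₅` is a sum of FULLY slot-symmetric pieces `Z_k`, the
`k`-th of split-rank `≤ n_k` across some pair split, then `Σ n_k ≥ 10` (transport every piece to the split `{0,1}` by a slot
permutation, which its symmetry allows, and flatten).  Typed for pair-split decompositions grouped by split value. -/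
theorem stub_symmetricPieces_needTen (N : ℕ) (T : Finset (Fin N)) (S : Fin N → Finset (Fin 5))
    (u w : Fin N → (Fin 5 → Fin 5) → ℂ) (hdec : IsSplitDecomposition T S u w) (hpair : ∀ t ∈ T, (S t).card = 2)
    (hsymm : ∀ A : Finset (Fin 5), SlotInvariantOn Finset.univ (fun v => ∑ t ∈ T.filter (fun t => S t = A), u t v * w t v)) :
    10 ≤ T.card := by
  -- CLOSED BY NAME ✓ p654341 (val-lit-p4 g14); hypotheses stated there fully unfolded.
  exact Summit.ValiantsHypothesis.ValiantsHypothesis.Theorems.RigidityForcesSymmetryRankRigidMinimalRepr.LaplaceFiveSymmetricPieces.symmetricPieces_needTen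
    N T S u w hdec hpair hsymm

/-- PROP A (rigid supports, first target of K1): a side-symmetric split decomposition of `P₅` by pair terms supported on at most
THREE distinct pair splits has ≥ 10 terms, i.e. weight ≥ 120 (separation ⟹ every shadow fully symmetric ⟹ catalecticant).
In particular the triangle profile `3·01 + 3·02 + 3·12` (an LM tail, weight 108, OPEN for general factors) has no
side-symmetric solution: its border tail, if real, lives in the asymmetric sector. -/
theorem stub_sideSym_threePairSplits (N : ℕ) (T : Finset (Fin N)) (S : Fin N → Finset (Fin 5))
    (u w : Fin N → (Fin 5 → Fin 5) → ℂ) (hdec : IsSplitDecomposition T S u w) (hsym : SideSymmetric T S u w)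
    (hpair : ∀ t ∈ T, (S t).card = 2) (h3 : (T.image S).card ≤ 3) :
    Nat.factorial 5 ≤ laplaceWeight T S := by
  -- CLOSED BY NAME ✓ p657029 (val-lit-p4 g14; stated over the port's defs, identical bodies).
  exact Summit.ValiantsHypothesis.ValiantsHypothesis.Theorems.RigidityForcesSymmetryRankRigidMinimalRepr.LaplaceFivePropA.sideSym_threePairSplits
    N T S u w hdec hsym hpair h3

/-! ### 3. Kernel facts: the certified star border family lives in the ASYMMETRIC sector

Factor data of p629937 in the normal form of `ArcHeightSketch.lean` (g5): pole terms `t = 0…7` on slot pairs `(0,j)`,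
`j = 1,1,2,2,3,3,4,4`, leading factors `a = (E,N,E,N,E,N,E,N)`, `p = (Y_A1, Y_B1, Y_A, Y_B, Y_A, −Y_B, −2Q, Y_B)`, first-order
`b = (0,0,M,M,M,−M,−M/2,0)`, `q = (R,U,R,U,R,U,R,U)`, ninth term `ε·M₀₁ ⊗ Q₂₃₄`.  Side symmetrisation, scaled to stay in `ℤ`:
`sym2 f = 2·Sym f`, `sym3 p = 6·Sym p`, so `sym2 a ⊗ sym3 p = 12 · (Sym a ⊗ Sym p)`. -/

/-- `E = e₀₃`. -/
def sE (x y : Fin 5) : ℤ := if (x = 0 ∧ y = 3) then 1 else 0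
/-- `N = e₁₃ + e₃₁`. -/
def sN (x y : Fin 5) : ℤ := if (x = 1 ∧ y = 3) ∨ (x = 3 ∧ y = 1) then 1 else 0
/-- `M = e₂₄ + e₄₂`. -/
def sM (x y : Fin 5) : ℤ := if (x = 2 ∧ y = 4) ∨ (x = 4 ∧ y = 2) then 1 else 0
/-- `Q` = arrangements of `{0,1,3}`. -/
def arrQ (x y z : Fin 5) : ℤ :=
  (if (x = 0 ∧ y = 1 ∧ z = 3) ∨ (x = 0 ∧ y = 3 ∧ z = 1) ∨ (x = 1 ∧ y = 0 ∧ z = 3) ∨ (x = 1 ∧ y = 3 ∧ z = 0) ∨ (x = 3 ∧ y = 0 ∧ z = 1) ∨ (x = 3 ∧ y = 1 ∧ z = 0) then (1 : ℤ) else 0)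
/-- `R` = arrangements of `{1,2,4}`. -/
def arrR (x y z : Fin 5) : ℤ :=
  (if (x = 1 ∧ y = 2 ∧ z = 4) ∨ (x = 1 ∧ y = 4 ∧ z = 2) ∨ (x = 2 ∧ y = 1 ∧ z = 4) ∨ (x = 2 ∧ y = 4 ∧ z = 1) ∨ (x = 4 ∧ y = 1 ∧ z = 2) ∨ (x = 4 ∧ y = 2 ∧ z = 1) then (1 : ℤ) else 0)
/-- `U` = arrangements of `{0,2,4}`. -/
def arrU (x y z : Fin 5) : ℤ :=
  (if (x = 0 ∧ y = 2 ∧ z = 4) ∨ (x = 0 ∧ y = 4 ∧ z = 2) ∨ (x = 2 ∧ y = 0 ∧ z = 4) ∨ (x = 2 ∧ y = 4 ∧ z = 0) ∨ (x = 4 ∧ y = 0 ∧ z = 2) ∨ (x = 4 ∧ y = 2 ∧ z = 0) then (1 : ℤ) else 0)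
/-- `Y_A1 = 2[013]+2[103]−2[130]−2[310]`. -/
def YA1 (x y z : Fin 5) : ℤ :=
  2 * (if (x = 0 ∧ y = 1 ∧ z = 3) ∨ (x = 1 ∧ y = 0 ∧ z = 3) then (1 : ℤ) else 0) - 2 * (if (x = 1 ∧ y = 3 ∧ z = 0) ∨ (x = 3 ∧ y = 1 ∧ z = 0) then (1 : ℤ) else 0)
/-- `Y_B1 = −[013]+[031]+[103]−[130]−[301]+[310]`. -/
def YB1 (x y z : Fin 5) : ℤ :=
  (if (x = 0 ∧ y = 3 ∧ z = 1) ∨ (x = 1 ∧ y = 0 ∧ z = 3) ∨ (x = 3 ∧ y = 1 ∧ z = 0) then (1 : ℤ) else 0) - (if (x = 0 ∧ y = 1 ∧ z = 3) ∨ (x = 1 ∧ y = 3 ∧ z = 0) ∨ (x = 3 ∧ y = 0 ∧ z = 1) then (1 : ℤ) else 0)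
/-- `Y_A = 2[013]+2[103]+2[310]`. -/
def YA (x y z : Fin 5) : ℤ :=
  2 * (if (x = 0 ∧ y = 1 ∧ z = 3) ∨ (x = 1 ∧ y = 0 ∧ z = 3) ∨ (x = 3 ∧ y = 1 ∧ z = 0) then (1 : ℤ) else 0)
/-- `Y_B = −[013]+[031]−[103]+[130]+[301]−[310]`. -/
def YB (x y z : Fin 5) : ℤ :=
  (if (x = 0 ∧ y = 3 ∧ z = 1) ∨ (x = 1 ∧ y = 3 ∧ z = 0) ∨ (x = 3 ∧ y = 0 ∧ z = 1) then (1 : ℤ) else 0) - (if (x = 0 ∧ y = 1 ∧ z = 3) ∨ (x = 1 ∧ y = 0 ∧ z = 3) ∨ (x = 3 ∧ y = 1 ∧ z = 0) then (1 : ℤ) else 0)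
/-- `P₅` as an integer function. -/
def pat5 (a b c d e : Fin 5) : ℤ :=
  if a ≠ b ∧ a ≠ c ∧ a ≠ d ∧ a ≠ e ∧ b ≠ c ∧ b ≠ d ∧ b ≠ e ∧ c ≠ d ∧ c ≠ e ∧ d ≠ e then 1 else 0

/-- `2 ·` the symmetrisation of a short (two-slot) factor. -/
def sym2 (f : Fin 5 → Fin 5 → ℤ) (x y : Fin 5) : ℤ := f x y + f y x
/-- `6 ·` the symmetrisation of a long (three-slot) factor. -/
def sym3 (p : Fin 5 → Fin 5 → Fin 5 → ℤ) (x y z : Fin 5) : ℤ :=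
  p x y z + p x z y + p y x z + p y z x + p z x y + p z y x

/-- Long-side symmetrisation KILLS the leading long factor `Y_A1` … -/
theorem longSym_kills_YA1 : ∀ x y z : Fin 5, sym3 YA1 x y z = 0 := by decide
/-- … and `Y_B1` … -/
theorem longSym_kills_YB1 : ∀ x y z : Fin 5, sym3 YB1 x y z = 0 := by decide
/-- … and `Y_B` (so the `N`-terms `t = 1,3,5,7` have NO leading shadow at all) … -/
theorem longSym_kills_YB : ∀ x y z : Fin 5, sym3 YB x y z = 0 := by decide
/-- … while `Y_A ↦ Q` (`6·Sym Y_A = 6·Q`): the `E`-terms on `02, 03, 04` keep a leading shadow `½ N₀₃ ⊗ (Q, Q, −2Q)`. -/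
theorem longSym_YA : ∀ x y z : Fin 5, sym3 YA x y z = 6 * arrQ x y z := by decide

/-- `12 ·` the side-symmetrised LEADING (`ε⁻¹`-relative) layer `Σ_t Sym a_t ⊗ Sym p_t` of the star border family, as a function
of the word `(a,b,c,d,e)` (term `t` on slots `(0, j_t)` reads its short factor at `(a, v_{j_t})` and its long factor at the other
three slots in increasing order). -/
def shadowLead12 (a b c d e : Fin 5) : ℤ :=
  sym2 sE a b * sym3 YA1 c d e + sym2 sN a b * sym3 YB1 c d e +
  sym2 sE a c * sym3 YA b d e + sym2 sN a c * sym3 YB b d e +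
  sym2 sE a d * sym3 YA b c e - sym2 sN a d * sym3 YB b c e -
  2 * (sym2 sE a e * sym3 arrQ b c d) + sym2 sN a e * sym3 YB b c d

/-- THE LEADING SYZYGY IS ASYMMETRIC (kernel): before symmetrisation the leading layer vanishes identically (`lead_syzygy` in
`ArcHeightSketch.lean`); after side symmetrisation it does not — value `−12/12 = −1` at the word `(0,3,0,1,3)`.  Hence the
isotypic flux of the family is `ε⁻¹ · (shadowLead12 / 12) + O(1) → ∞`. -/
theorem shadowLead12_witness : shadowLead12 0 3 0 1 3 = -12 := by decide

/-- SUPPORT of the divergent shadow (kernel): it lives on words of letter content `{0,0,1,3,3}` only (24 words, values `±6, ±12`);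
in particular it vanishes on injective words and has zero `(5)`-isotypic (polynomial) part — its isotypic content is
`(4,1) ⊕ (3,2)` (norms² 4 + 8 of 12, calc/isotypic.py E4b). -/
theorem shadowLead12_support : ∀ a b c d e : Fin 5, shadowLead12 a b c d e ≠ 0 →
    ((if a = 0 then 1 else 0) + (if b = 0 then 1 else 0) + (if c = 0 then 1 else 0) + (if d = 0 then 1 else 0) + (if e = 0 then 1 else 0) = (2 : ℕ)) ∧
    ((if a = 1 then 1 else 0) + (if b = 1 then 1 else 0) + (if c = 1 then 1 else 0) + (if d = 1 then 1 else 0) + (if e = 1 then 1 else 0) = (1 : ℕ)) ∧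
    ((if a = 3 then 1 else 0) + (if b = 3 then 1 else 0) + (if c = 3 then 1 else 0) + (if d = 3 then 1 else 0) + (if e = 3 then 1 else 0) = (2 : ℕ)) := by
  decide

/-- `12 ·` the side-symmetrised `ε⁰` layer `Σ_t (Sym a_t ⊗ Sym q_t + Sym b_t ⊗ Sym p_t) + Sym M ⊗ Sym Q` (which equals `12·P₅`
BEFORE symmetrisation: `filed_order_one2` in `ArcHeightSketch.lean`). -/
def shadowOne12 (a b c d e : Fin 5) : ℤ :=
  sym2 sE a b * sym3 arrR c d e + sym2 sN a b * sym3 arrU c d e + sym2 sM a b * sym3 arrQ c d e +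
  sym2 sE a c * sym3 arrR b d e + sym2 sM a c * sym3 YA b d e +
  sym2 sN a c * sym3 arrU b d e + sym2 sM a c * sym3 YB b d e +
  sym2 sE a d * sym3 arrR b c e + sym2 sM a d * sym3 YA b c e +
  sym2 sN a d * sym3 arrU b c e + sym2 sM a d * sym3 YB b c e +
  sym2 sE a e * sym3 arrR b c d + sym2 sM a e * sym3 arrQ b c d +
  sym2 sN a e * sym3 arrU b c d

/-- The symmetrised `ε⁰` layer is NOT `P₅` (kernel): `6 ≠ 12` at the injective word `01234` (it is off by `±½` on 48 injective
words) — the border identity is destroyed order by order by passing to the symmetric sector. -/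
theorem shadowOne12_witness : shadowOne12 0 1 2 3 4 = 6 ∧ 12 * pat5 0 1 2 3 4 = 12 := by decide

end Summit.ValiantsHypothesis.ValiantsHypothesis.Cruxes.LaplaceOptimalFive.YoungShadow
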